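import Literature.NumberTheory.EllipticCurves.BSDSelmerParityDokchitserBaseChangeProofs
import HarnessLib

/-!
# The quadratic-twist substitution on points over ANY field containing `√c`, and its naturality — the local ingredient of kernel brick 2 of the transport [C] (cell `b2b-bsdres`, seat additive-p1, gen 8)

HONEST FRAMING (cell `b2b-bsdres`, run/shared/lean/b2b/bsd-rank1-residual/, verbatim in every
file): the goal of the cell is to DELETE the COMBINATION-SHAPED residual classes of the
Birch–Swinnerton-Dyer formula for ALL analytic-rank `≤ 1` elliptic curves over `ℚ` — "full BSD
formula for every rank `≤ 1` curve in class `C`" assembled STRICTLY from published theorems — so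
that the rank-`≤ 1` remainder becomes exactly the CONSTRUCTION-SHAPED classes, which are TYPED
(missing-input `Prop`s), NOT attempted. This is not "finishing BSD". The additive sub-cell (seats
additive-p1…p4) is a RESEARCH ROUTE on the construction-shaped classes X3/X4; sub-cell additive-p1
= the potentially MULTIPLICATIVE additive prime (X3♯(M) / X4(M)); no claim beyond the stated
classes; the labels of X3/X4 are UNCHANGED by this file; nothing is booked.

Definitions = concrete additive isomorphisms assembled from tree isomorphisms (no predicate, no
named fact) and theorems. Context: design HOME/b2b-bsdres-additive-p1/KERNEL-C-P3.md, brick 2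
(twist transport over the infinite extension `F_∞ ∋ √c`). The Selmer LOCAL CONDITIONS of the
tree's subgroup model (`WeierstrassCurve.localKerOver`, file `SubgroupSelmer`) are kernels of
`H¹(H, E[p^∞]) → H¹(H_v, E(ℚ̄_v))` along the coordinate map `E(ℚ̄) → E(ℚ̄_v)`
(`pointsMapOfEmb`); to transport them along the twist one needs the twist isomorphism on points
over EVERY field `A` of characteristic `0` containing a square root `t` of `c`, functorially in `A`. This file
provides exactly that:

* `twistPointEquivOver W ht htc : E^{(c)}(A) ≃+ E(A)` for `t ∈ A ∖ ℚ`, `t² = c` — the substitution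
  `u = t` onto the completed-square model `E^{(1)}` (the tree's `twistUntwist`,
  `twistUntwist_smul_baseChange`) followed by the inverse of the completed square `sqChange W`
  (both through the tree's `VariableChange.pointEquiv` and `Affine.Point.congrEquiv`);
* `map_twistPointEquivOver` — NATURALITY: for a `ℚ`-algebra map `f : A → B` with `f t_A = t_B`,
  `f_* ∘ Φ_A = Φ_B ∘ f_*` on points (`Affine.Point.map`);
* `map_twistPointEquivOver_of_neg` — ANTI-naturality: if `f t_A = −t_B` then
  `f_* ∘ Φ_A = −Φ_B ∘ f_*` (the quadratic character);
* over `ℚ̄` with `t = embIntoClosure K θ` (`K = ℚ(θ)`, `θ² = c`): `twistGeomEquiv`,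
  `E^{(c)}(ℚ̄) ≃+ E(ℚ̄)`, `galRange K`-EQUIVARIANT (`twistGeomEquiv_smul_of_mem`) and
  ANTI-equivariant off `galRange K` (`twistGeomEquiv_smul_of_not_mem`), with its restriction
  `twistPrimaryEquiv : E^{(c)}[p^∞] ≃+ E[p^∞]` — a coordinate-level twin of the tree's `psiQ`
  whose compatibility with the local coordinate maps is by construction (`map_twistPointEquivOver`
  with `f = ι : ℚ̄ → ℚ̄_v`).

References: J. H. Silverman, *AEC* (2009), X.2 Prop. 2.4, X.5 Cor. 5.4 [SilvermanAEC2009];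
T. Dokchitser, *Notes on the parity conjecture* (2013), §4 [Dokchitser2013ParityNotes].
-/

noncomputable section

open scoped Classical

universe u v

namespace Summit.BirchSwinnertonDyer.Rank1Residual.AdditivePotMult

open Literature.NumberTheory.EllipticCurves Literature.NumberTheory.GaloisRepresentations
  WeierstrassCurve

/-! ## §1 The substitution over a field `A ∋ t`, `t² = c` -/

section Over

variable (W : WeierstrassCurve ℚ) {A : Type u} [Field A] [CharZero A] {t : A}
  {c : ℚ} (ht : t ∉ Set.range (algebraMap ℚ A)) (htc : t ^ 2 = algebraMap ℚ A c)

/-- Step 1: `E^{(c)}(A) ≃+ E^{(1)}(A)`, the substitution `u = t` (`twistUntwist`) followed by the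
transport along `u • E^{(c)}_A = E^{(1)}_A` (`twistUntwist_smul_baseChange`). Silverman, *AEC*,
X.5 Cor. 5.4. [cite: SilvermanAEC2009, X.5 Cor. 5.4] -/
def twistStepOne :
    ((W.quadraticTwist c).baseChange A).toAffine.Point ≃+
      ((W.quadraticTwist 1).baseChange A).toAffine.Point :=
  (VariableChange.pointEquiv ((W.quadraticTwist c).baseChange A) (twistUntwist ht)).trans
    (Affine.Point.congrEquiv (twistUntwist_smul_baseChange W ht htc))

/-- Step 2: `E(A) ≃+ E^{(1)}(A)`, the completed square `sqChange W` (rational coefficients) viewed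
over `A`, followed by the transport along `C_A • E_A = E^{(1)}_A`. [folklore] -/
def twistStepTwo :
    (W.baseChange A).toAffine.Point ≃+ ((W.quadraticTwist 1).baseChange A).toAffine.Point :=
  (VariableChange.pointEquiv (W.baseChange A) ((sqChange W).map (algebraMap ℚ A))).trans
    (Affine.Point.congrEquiv (map_smul_baseChange_eq_quadraticTwist_one W (sqChange_spec W) (K := A)))

/-- **The twist substitution `Φ_A : E^{(c)}(A) ≃+ E(A)` over any field `A ⊇ ℚ` containing a square
root `t ∉ ℚ` of `c`** (`(X, Y) ↦ (X/t², Y/t³)` onto `E^{(1)}`, then un-completing the square).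
Silverman, *AEC*, X.2 Prop. 2.4, X.5 Cor. 5.4. [cite: SilvermanAEC2009, X.5 Cor. 5.4] -/
def twistPointEquivOver :
    ((W.quadraticTwist c).baseChange A).toAffine.Point ≃+ (W.baseChange A).toAffine.Point :=
  (twistStepOne W ht htc).trans (twistStepTwo W (A := A)).symm

/-- Step 1 on an affine point. [folklore] -/
theorem twistStepOne_some {x y : A}
    (h : ((W.quadraticTwist c).baseChange A).toAffine.Nonsingular x y) :
    twistStepOne W ht htc (.some x y h) =
      .some ((twistUntwist ht).toX x) ((twistUntwist ht).toY x y)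
        ((twistUntwist_smul_baseChange W ht htc) ▸
          (VariableChange.nonsingular_iff _ (twistUntwist ht) x y).mpr h) := by
  simp only [twistStepOne, AddEquiv.trans_apply, VariableChange.pointEquiv_some,
    Affine.Point.congrEquiv_some]

/-- Step 2 on an affine point. [folklore] -/
theorem twistStepTwo_some {x y : A} (h : (W.baseChange A).toAffine.Nonsingular x y) :
    twistStepTwo W (.some x y h) =
      .some (((sqChange W).map (algebraMap ℚ A)).toX x)
        (((sqChange W).map (algebraMap ℚ A)).toY x y)
        ((map_smul_baseChange_eq_quadraticTwist_one W (sqChange_spec W) (K := A)) ▸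
          (VariableChange.nonsingular_iff _ ((sqChange W).map (algebraMap ℚ A)) x y).mpr h) := by
  simp only [twistStepTwo, AddEquiv.trans_apply, VariableChange.pointEquiv_some,
    Affine.Point.congrEquiv_some]

/-- `Φ_A = (step 2)⁻¹ ∘ (step 1)`. [folklore] -/
theorem twistPointEquivOver_apply (P : ((W.quadraticTwist c).baseChange A).toAffine.Point) :
    twistPointEquivOver W ht htc P = (twistStepTwo W (A := A)).symm (twistStepOne W ht htc P) :=
  rfl

/-- The coordinates of step 1: `u⁻² X = t⁻² X`, `u⁻³ Y = t⁻³ Y`. [folklore] -/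
theorem toX_toY_twistUntwist (x y : A) :
    (twistUntwist ht).toX x = t⁻¹ ^ 2 * x ∧ (twistUntwist ht).toY x y = t⁻¹ ^ 3 * y := by
  simp only [VariableChange.toX_def, VariableChange.toY_def, twistUntwist, sub_zero, zero_mul,
    Units.val_inv_eq_inv_val, Units.val_mk0, and_self]

end Over

/-! ## §2 Naturality in the field -/

section Natural

variable (W : WeierstrassCurve ℚ) {A : Type u} [Field A] [CharZero A] {t : A}
  {c : ℚ} (ht : t ∉ Set.range (algebraMap ℚ A)) (htc : t ^ 2 = algebraMap ℚ A c)
  {B : Type v} [Field B] [CharZero B] {t' : B}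
  (ht' : t' ∉ Set.range (algebraMap ℚ B)) (htc' : t' ^ 2 = algebraMap ℚ B c)
  (f : A →ₐ[ℚ] B)

/-- Step 2 is natural in the field (its coefficients are rational: `map_toX`, `map_toY`).
[folklore] -/
theorem map_twistStepTwo (P : (W.baseChange A).toAffine.Point) :
    Affine.Point.map f (twistStepTwo W P) = twistStepTwo W (Affine.Point.map f P) := by
  rcases P with _ | ⟨x, y, h⟩
  · simp only [← Affine.Point.zero_def, map_zero]
  · rw [twistStepTwo_some, Affine.Point.map_some, Affine.Point.map_some, twistStepTwo_some]
    simp only [VariableChange.map_toX, VariableChange.map_toY]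

/-- Step 1 is natural along `f` with `f t = t'`. [folklore] -/
theorem map_twistStepOne (hft : f t = t')
    (P : ((W.quadraticTwist c).baseChange A).toAffine.Point) :
    Affine.Point.map f (twistStepOne W ht htc P) =
      twistStepOne W ht' htc' (Affine.Point.map f P) := by
  rcases P with _ | ⟨x, y, h⟩
  · simp only [← Affine.Point.zero_def, map_zero]
  · rw [twistStepOne_some, Affine.Point.map_some, Affine.Point.map_some, twistStepOne_some]
    obtain ⟨hX, hY⟩ := toX_toY_twistUntwist ht x y
    obtain ⟨hX', hY'⟩ := toX_toY_twistUntwist ht' (f x) (f y)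
    simp only [Affine.Point.some.injEq]
    refine ⟨?_, ?_⟩
    · rw [hX, hX', map_mul, map_pow, map_inv₀, hft]
    · rw [hY, hY', map_mul, map_pow, map_inv₀, hft]

/-- Step 1 is ANTI-natural along `f` with `f t = −t'`: the `y`-coordinate changes sign, which
is negation on the completed-square model `E^{(1)}` (`negY = −y` there). [folklore] -/
theorem map_twistStepOne_of_neg (hft : f t = -t')
    (P : ((W.quadraticTwist c).baseChange A).toAffine.Point) :
    Affine.Point.map f (twistStepOne W ht htc P) =
      -twistStepOne W ht' htc' (Affine.Point.map f P) := by
  rcases P with _ | ⟨x, y, h⟩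
  · simp only [← Affine.Point.zero_def, map_zero, neg_zero]
  · rw [twistStepOne_some, Affine.Point.map_some, Affine.Point.map_some, twistStepOne_some,
      Affine.Point.neg_some]
    obtain ⟨hX, hY⟩ := toX_toY_twistUntwist ht x y
    obtain ⟨hX', hY'⟩ := toX_toY_twistUntwist ht' (f x) (f y)
    simp only [Affine.Point.some.injEq]
    rw [QuadraticDescent.negY_quadraticTwist_one_baseChange]
    refine ⟨?_, ?_⟩
    · rw [hX, hX', map_mul, map_pow, map_inv₀, hft]
      ring
    · rw [hY, hY', map_mul, map_pow, map_inv₀, hft]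
      ring

/-- **Naturality of the twist substitution**: for a `ℚ`-algebra map `f : A → B` with
`f t = t'`, `f_* (Φ_A P) = Φ_B (f_* P)`. [folklore] -/
theorem map_twistPointEquivOver (hft : f t = t')
    (P : ((W.quadraticTwist c).baseChange A).toAffine.Point) :
    Affine.Point.map f (twistPointEquivOver W ht htc P) =
      twistPointEquivOver W ht' htc' (Affine.Point.map f P) := by
  rw [twistPointEquivOver_apply, twistPointEquivOver_apply]
  apply (twistStepTwo W (A := B)).injective
  rw [AddEquiv.apply_symm_apply, ← map_twistStepTwo, AddEquiv.apply_symm_apply,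
    map_twistStepOne W ht htc ht' htc' f hft]

/-- **Anti-naturality**: for `f : A → B` with `f t = −t'`, `f_* (Φ_A P) = −Φ_B (f_* P)` — the
Galois action on `E^{(c)}` is that on `E` twisted by the quadratic character. T. Dokchitser 2013,
§4. [cite: Dokchitser2013ParityNotes, §4] -/
theorem map_twistPointEquivOver_of_neg (hft : f t = -t')
    (P : ((W.quadraticTwist c).baseChange A).toAffine.Point) :
    Affine.Point.map f (twistPointEquivOver W ht htc P) =
      -twistPointEquivOver W ht' htc' (Affine.Point.map f P) := by
  rw [twistPointEquivOver_apply, twistPointEquivOver_apply]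
  apply (twistStepTwo W (A := B)).injective
  rw [map_neg, AddEquiv.apply_symm_apply, ← map_twistStepTwo, AddEquiv.apply_symm_apply,
    map_twistStepOne_of_neg W ht htc ht' htc' f hft]

end Natural

/-! ## §3 Over `ℚ̄`: the twist isomorphism of Galois modules with its sign rule -/

section Geom

variable (W : WeierstrassCurve ℚ) (K : Type) [Field K] [NumberField K]
  (h2 : Module.finrank ℚ K = 2) {θ : K} {c : ℚ} (hθ : θ ∉ Set.range (algebraMap ℚ K))
  (hc : θ ^ 2 = algebraMap ℚ K c)

/-- The square root `t = embIntoClosure K θ ∈ ℚ̄` of `c`. [folklore] -/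
def rootInClosure (θ : K) : AlgebraicClosure ℚ := embIntoClosure (K := ℚ) K θ

include hθ in
/-- `t ∉ ℚ`. [folklore] -/
theorem rootInClosure_not_mem : rootInClosure K θ ∉ Set.range (algebraMap ℚ (AlgebraicClosure ℚ)) := by
  rintro ⟨q, hq⟩
  apply hθ
  refine ⟨q, (embIntoClosure (K := ℚ) K).toRingHom.injective ?_⟩
  change embIntoClosure (K := ℚ) K (algebraMap ℚ K q) = embIntoClosure (K := ℚ) K θ
  rw [AlgHom.commutes]
  rw [eq_ratCast] at hq ⊢
  exact hq

include hc in
/-- `t² = c`. [folklore] -/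
theorem rootInClosure_sq : rootInClosure K θ ^ 2 = algebraMap ℚ (AlgebraicClosure ℚ) c := by
  rw [rootInClosure, ← map_pow, hc, AlgHom.commutes, eq_ratCast, eq_ratCast]

/-- **The twist isomorphism `E^{(c)}(ℚ̄) ≃+ E(ℚ̄)` in coordinates** (`t = embIntoClosure K θ`).
Silverman, *AEC*, X.5 Cor. 5.4. [cite: SilvermanAEC2009, X.5 Cor. 5.4] -/
def twistGeomEquiv : geomPoints (W.quadraticTwist c) ≃+ geomPoints W :=
  twistPointEquivOver W (rootInClosure_not_mem K hθ) (rootInClosure_sq K hc)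

/-- `g ∈ galRange K = Gal(ℚ̄/K)` fixes `t`. [folklore] -/
theorem apply_rootInClosure_of_mem {g : Field.absoluteGaloisGroup ℚ}
    (hg : g ∈ galRange (K := ℚ) K) :
    (show AlgebraicClosure ℚ ≃ₐ[ℚ] AlgebraicClosure ℚ from g) (rootInClosure K θ) =
      rootInClosure K θ :=
  smul_embIntoClosure_of_mem_galRange K hg θ

include h2 hθ hc in
/-- `g ∉ galRange K` sends `t` to `−t` (`g = u · c₀` with `u ∈ galRange K`, `c₀ θ = −θ`).
[folklore] -/
theorem apply_rootInClosure_of_not_mem {g : Field.absoluteGaloisGroup ℚ}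
    (hg : g ∉ galRange (K := ℚ) K) :
    (show AlgebraicClosure ℚ ≃ₐ[ℚ] AlgebraicClosure ℚ from g) (rootInClosure K θ) =
      -rootInClosure K θ := by
  haveI : IsGalois ℚ K := isGalois_of_finrank_eq_two K h2
  -- `c₀ t = -t`
  have hc₀t : (show AlgebraicClosure ℚ ≃ₐ[ℚ] AlgebraicClosure ℚ from
      liftToAbsGal (K := ℚ) K (sigmaQ K h2 hθ hc)) (rootInClosure K θ) = -rootInClosure K θ := by
    have h := liftToAbsGal_embIntoClosure (K := ℚ) K (sigmaQ K h2 hθ hc) θ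
    rw [sigmaQ_gen, map_neg] at h
    exact h
  -- hence `c₀⁻¹ t = -t`
  have hinv : (show AlgebraicClosure ℚ ≃ₐ[ℚ] AlgebraicClosure ℚ from
      (liftToAbsGal (K := ℚ) K (sigmaQ K h2 hθ hc))⁻¹) (rootInClosure K θ) = -rootInClosure K θ := by
    have h1 : (show AlgebraicClosure ℚ ≃ₐ[ℚ] AlgebraicClosure ℚ from
        (liftToAbsGal (K := ℚ) K (sigmaQ K h2 hθ hc))⁻¹)
        ((show AlgebraicClosure ℚ ≃ₐ[ℚ] AlgebraicClosure ℚ from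
          liftToAbsGal (K := ℚ) K (sigmaQ K h2 hθ hc)) (rootInClosure K θ)) = rootInClosure K θ :=
      AlgEquiv.symm_apply_apply _ _
    rw [hc₀t, map_neg, neg_eq_iff_eq_neg] at h1
    exact h1
  -- `g c₀⁻¹ ∈ galRange K` fixes `t`
  have hu : g * (liftToAbsGal (K := ℚ) K (sigmaQ K h2 hθ hc))⁻¹ ∈ galRange (K := ℚ) K :=
    (xor_galRange K h2 (sigmaQ_ne_one K h2 hθ hc) g).or.resolve_right hg
  have h3 := smul_embIntoClosure_of_mem_galRange K hu θ
  change (show AlgebraicClosure ℚ ≃ₐ[ℚ] AlgebraicClosure ℚ from g)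
    ((show AlgebraicClosure ℚ ≃ₐ[ℚ] AlgebraicClosure ℚ from
      (liftToAbsGal (K := ℚ) K (sigmaQ K h2 hθ hc))⁻¹) (rootInClosure K θ)) =
      rootInClosure K θ at h3
  rw [hinv, map_neg, neg_eq_iff_eq_neg] at h3
  exact h3

/-- **`Gal(ℚ̄/K)`-equivariance**: `Φ (g • P) = g • Φ P` for `g ∈ galRange K`. [folklore] -/
theorem twistGeomEquiv_smul_of_mem {g : Field.absoluteGaloisGroup ℚ}
    (hg : g ∈ galRange (K := ℚ) K) (P : geomPoints (W.quadraticTwist c)) :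
    twistGeomEquiv W K hθ hc (g • P) = g • twistGeomEquiv W K hθ hc P := by
  change twistPointEquivOver W (rootInClosure_not_mem K hθ) (rootInClosure_sq K hc)
      (Affine.Point.map ((show AlgebraicClosure ℚ ≃ₐ[ℚ] AlgebraicClosure ℚ from g) :
        AlgebraicClosure ℚ →ₐ[ℚ] AlgebraicClosure ℚ) P) =
    Affine.Point.map ((show AlgebraicClosure ℚ ≃ₐ[ℚ] AlgebraicClosure ℚ from g) :
        AlgebraicClosure ℚ →ₐ[ℚ] AlgebraicClosure ℚ)
      (twistPointEquivOver W (rootInClosure_not_mem K hθ) (rootInClosure_sq K hc) P)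
  rw [map_twistPointEquivOver W (rootInClosure_not_mem K hθ) (rootInClosure_sq K hc)
    (rootInClosure_not_mem K hθ) (rootInClosure_sq K hc) _ (apply_rootInClosure_of_mem K hg)]
  rfl

include h2 in
/-- **The sign rule**: `Φ (g • P) = −(g • Φ P)` for `g ∉ galRange K` — the Galois module
`E^{(c)}[p^∞]` is `E[p^∞]` twisted by the quadratic character of `K`. T. Dokchitser 2013, §4.
[cite: Dokchitser2013ParityNotes, §4] -/
theorem twistGeomEquiv_smul_of_not_mem {g : Field.absoluteGaloisGroup ℚ}
    (hg : g ∉ galRange (K := ℚ) K) (P : geomPoints (W.quadraticTwist c)) :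
    twistGeomEquiv W K hθ hc (g • P) = -(g • twistGeomEquiv W K hθ hc P) := by
  change twistPointEquivOver W (rootInClosure_not_mem K hθ) (rootInClosure_sq K hc)
      (Affine.Point.map ((show AlgebraicClosure ℚ ≃ₐ[ℚ] AlgebraicClosure ℚ from g) :
        AlgebraicClosure ℚ →ₐ[ℚ] AlgebraicClosure ℚ) P) =
    -Affine.Point.map ((show AlgebraicClosure ℚ ≃ₐ[ℚ] AlgebraicClosure ℚ from g) :
        AlgebraicClosure ℚ →ₐ[ℚ] AlgebraicClosure ℚ)
      (twistPointEquivOver W (rootInClosure_not_mem K hθ) (rootInClosure_sq K hc) P)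
  rw [map_twistPointEquivOver_of_neg W (rootInClosure_not_mem K hθ) (rootInClosure_sq K hc)
    (rootInClosure_not_mem K hθ) (rootInClosure_sq K hc) _
    (apply_rootInClosure_of_not_mem K h2 hθ hc hg), neg_neg]
  rfl

variable (p : ℕ)

/-- **`E^{(c)}[p^∞] ≃+ E[p^∞]`**, the restriction of `twistGeomEquiv` to `p`-primary torsion.
[folklore] -/
def twistPrimaryEquiv : geomPrimaryTorsion (W.quadraticTwist c) p ≃+ geomPrimaryTorsion W p :=
  primaryComponentCongr (twistGeomEquiv W K hθ hc) p

/-- Values of `twistPrimaryEquiv`. [folklore] -/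
theorem coe_twistPrimaryEquiv (m : geomPrimaryTorsion (W.quadraticTwist c) p) :
    (twistPrimaryEquiv W K hθ hc p m : geomPoints W) = twistGeomEquiv W K hθ hc m :=
  rfl

/-- `twistPrimaryEquiv` is `galRange K`-equivariant. [folklore] -/
theorem twistPrimaryEquiv_smul_of_mem {g : Field.absoluteGaloisGroup ℚ}
    (hg : g ∈ galRange (K := ℚ) K) (m : geomPrimaryTorsion (W.quadraticTwist c) p) :
    twistPrimaryEquiv W K hθ hc p (g • m) = g • twistPrimaryEquiv W K hθ hc p m :=
  Subtype.ext (by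
    rw [coe_twistPrimaryEquiv, primaryComponent.coe_smul, primaryComponent.coe_smul,
      coe_twistPrimaryEquiv, twistGeomEquiv_smul_of_mem W K hθ hc hg])

include h2 in
/-- `twistPrimaryEquiv` is anti-equivariant off `galRange K`. [cite: Dokchitser2013ParityNotes, §4] -/
theorem twistPrimaryEquiv_smul_of_not_mem {g : Field.absoluteGaloisGroup ℚ}
    (hg : g ∉ galRange (K := ℚ) K) (m : geomPrimaryTorsion (W.quadraticTwist c) p) :
    twistPrimaryEquiv W K hθ hc p (g • m) = -(g • twistPrimaryEquiv W K hθ hc p m) :=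
  Subtype.ext (by
    rw [coe_twistPrimaryEquiv, primaryComponent.coe_smul, NegMemClass.coe_neg,
      primaryComponent.coe_smul, coe_twistPrimaryEquiv,
      twistGeomEquiv_smul_of_not_mem W K h2 hθ hc hg])

/-- `twistPrimaryEquiv` is `H`-equivariant for every `H ≤ galRange K`. [folklore] -/
theorem twistPrimaryEquiv_smul_of_le {H : Subgroup (Field.absoluteGaloisGroup ℚ)}
    (hH : H ≤ galRange (K := ℚ) K) (h : H) (m : geomPrimaryTorsion (W.quadraticTwist c) p) :
    twistPrimaryEquiv W K hθ hc p (h • m) = h • twistPrimaryEquiv W K hθ hc p m :=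
  twistPrimaryEquiv_smul_of_mem W K hθ hc p (hH h.2) m

end Geom

end Summit.BirchSwinnertonDyer.Rank1Residual.AdditivePotMult

end
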